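import Mathlib
import Literature.Analysis.ODE.RegularSingularLogBranch
import Literature.Analysis.ODE.RegularSingularScalarSystem
import HarnessLib

/-!
# The logarithmic Frobenius branch, scalar form: `x y″ + p(x) y′ + q(x) y = 0` with `p(0) = 0`
# (indicial exponents `{0, 1}`), over `𝕜 = ℝ` or `ℂ`

Topic `Literature/Analysis/ODE` (namespace `Literature.Analysis.ODE`). The scalar face of
`RegularSingularLogBranch.lean`. For `x y″ + p(x) y′ + q(x) y = 0` with `p, q` analytic at `0` and `p₀ = p(0) = 0`
the indicial exponents are `{0, 1}` (they differ by an integer: the RESONANT case excluded from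
`RegularSingularScalarBranch.lean` whenever one asks for `y(0) ≠ 0`). The classical picture
[cite: CoddingtonLevinson1955, Ch. 4 §8]: a SMALL solution `y_s = x + O(x²)` analytic at `0`, and a LARGE solution
`y_L = κ y_s log x + η(x)`, `η` analytic, `η(0) = 1`, `κ = −q₀` — logarithmic unless `q₀ = 0`. This is the local
structure of the marginal tearing-mode equation at a rational surface («`B₁ₓ` has logarithmic singularity at
`x = 0` since `F″/F ∝ 1/x`», Miyamoto, *Controlled Fusion and Plasma Physics* (2007) §9.1), whose symmetric jump
`Δ′` is extracted in `Literature/MathematicalPhysics/MHD/TearingOuterRegion.lean` (`Tearing.isDeltaPrime_of_logBranch`).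

Everything is QUANTITATIVE and over `RCLike 𝕜` (so real equations are treated on the real line, both sides of `0`,
with `ℓ = Real.log = log|·|`):
* the system `x v′ = M(x) v`, `v = (y, y′)` and its resolvents over `RCLike 𝕜` are `scalarSysM`, `scalarSysR` of
  `RegularSingularScalarSystem.lean`;
* `IsScalarLogData pc qc p q a K ρ₀` — the hypotheses (`‖pₖ‖, ‖qₖ‖ ≤ K aᵏ` for `k ≥ 1`, `p₀ = 0`, `p = Σ pₖ xᵏ`,
  `q = Σ qₖ xᵏ` on `‖x‖ < ρ₀`); explicit constants `scalarLogC = max 1 (‖q₀‖ + 1)`, rates `scalarLogLam` (`λ`),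
  `scalarLogLam'` (`λ'`) and the common radius `scalarLogRadius = min ρ₀ (1/(λ' + 1))`;
* `scalarSmallSol` — `(y_s, y_s′)`, the analytic branch through `(0, 1)`; `scalarLogRegSol η₀ ζ₀` — the regular part
  `(η, ζ)` through `(η₀, ζ₀)` (`κ = −q₀ η₀`, `ζ = η′ + κ y_s/x`); `scalarLogSol η₀ ζ₀ ℓ` — `(y_L, y_L′) = κ ℓ (y_s, y_s′) + (η, ζ)`;
* `IsScalarLogData.smallSol`, `.logRegSol`, `.logSol` — THE THEOREMS inside the explicit radius (values at `0`,
  differentiability, the equations `x y_s″ + p y_s′ + q y_s = 0`, `x η′ = x ζ − κ y_s`, `x ζ′ + p ζ + q η = −κ y_s′`,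
  and `x y_L″ + p y_L′ + q y_L = 0` at every `x ≠ 0` where `ℓ′(x) = x⁻¹`), with the coefficient majorants of
  `IsFrobeniusData` available through `.small` / `.logReg` (and formal uniqueness through `scalarSysR_leftInverse` +
  `frobeniusCoeff_unique`, which is how a certificate validates finitely many computed coefficients);
* `exists_logBranch_scalar` — the classical statement; `IsScalarLogData.logSol_real` — the real-line form with
  `ℓ = Real.log` on both sides of `0`.

## References
* E. A. Coddington, N. Levinson, *Theory of Ordinary Differential Equations*, McGraw–Hill 1955, Ch. 4 §8
  (second-order equations with a regular singular point; the logarithmic case). Key `CoddingtonLevinson1955`.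
* P. Hartman, *Ordinary Differential Equations*, SIAM Classics 38 (2002), Ch. IV §§11–12. Key `Hartman2002`.
-/

noncomputable section

open Finset Filter Metric
open scoped Topology NNReal ENNReal

namespace Literature.Analysis.ODE

variable {𝕜 : Type*} [RCLike 𝕜]

/-! ### The resonant case `p₀ = 0`: the small solution and the logarithmic branch -/

section Resonant

variable {pc qc : ℕ → 𝕜} {p q : 𝕜 → 𝕜} {a K ρ₀ : ℝ}

/-- The data of a scalar equation `x y″ + p(x) y′ + q(x) y = 0` with `p(x) = Σ pₖ xᵏ`, `q(x) = Σ qₖ xᵏ` on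
`‖x‖ < ρ₀`, geometric coefficient bounds `‖pₖ‖, ‖qₖ‖ ≤ K aᵏ` (`k ≥ 1`), and `p₀ = 0` — i.e. INDICIAL EXPONENTS
`{0, 1}` (the resonant case of the marginal tearing-mode / cylindrical Newcomb equation at a rational surface).
[cite: CoddingtonLevinson1955, Ch. 4 §8] -/
structure IsScalarLogData (pc qc : ℕ → 𝕜) (p q : 𝕜 → 𝕜) (a K ρ₀ : ℝ) : Prop where
  /-- `0 < a` -/
  a_pos : 0 < a
  /-- `0 ≤ K` -/
  K_nonneg : 0 ≤ K
  /-- `0 < ρ₀` -/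
  ρ₀_pos : 0 < ρ₀
  /-- `‖pₖ‖ ≤ K aᵏ` for `k ≥ 1` -/
  norm_pc_le : ∀ k : ℕ, 1 ≤ k → ‖pc k‖ ≤ K * a ^ k
  /-- `‖qₖ‖ ≤ K aᵏ` for `k ≥ 1` -/
  norm_qc_le : ∀ k : ℕ, 1 ≤ k → ‖qc k‖ ≤ K * a ^ k
  /-- `p₀ = 0`: the indicial exponents are `{0, 1}` -/
  pc_zero : pc 0 = 0
  /-- `p(x) = Σ xᵏ pₖ` on `‖x‖ < ρ₀` -/
  hasSum_p : ∀ x : 𝕜, ‖x‖ < ρ₀ → HasSum (fun k => x ^ k * pc k) (p x)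
  /-- `q(x) = Σ xᵏ qₖ` on `‖x‖ < ρ₀` -/
  hasSum_q : ∀ x : 𝕜, ‖x‖ < ρ₀ → HasSum (fun k => x ^ k * qc k) (q x)

/-- The constant `c = max 1 (‖q₀‖ + 1)` of the resolvent bound `‖Rₙ‖ ≤ c/n` (here `μ = 1`). [cite: CoddingtonLevinson1955, Ch. 4 §8] -/
def scalarLogC (qc : ℕ → 𝕜) : ℝ := max 1 (‖qc 0‖ + 1)

/-- The geometric rate `λ = a (1 + 2c(2K + a⁻¹))` of the coefficients of the small solution. [cite: CoddingtonLevinson1955, Ch. 4 §8] -/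
def scalarLogLam (qc : ℕ → 𝕜) (a K : ℝ) : ℝ := a * (1 + 2 * scalarLogC qc * (2 * K + a⁻¹))

/-- The geometric rate `λ' = λ (1 + 2c(2K + a⁻¹))` of the coefficients of the regular part of the log branch. [cite: CoddingtonLevinson1955, Ch. 4 §8] -/
def scalarLogLam' (qc : ℕ → 𝕜) (a K : ℝ) : ℝ := scalarLogLam qc a K * (1 + 2 * scalarLogC qc * (2 * K + a⁻¹))

/-- An explicit common radius: `ρ = min ρ₀ (1/(λ' + 1))`. [cite: CoddingtonLevinson1955, Ch. 4 §8] -/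
def scalarLogRadius (qc : ℕ → 𝕜) (a K ρ₀ : ℝ) : ℝ := min ρ₀ (1 / (scalarLogLam' qc a K + 1))

/-- **The small solution** `(y_s, y_s′)` of `x y″ + p y′ + q y = 0` (`p₀ = 0`): the analytic Frobenius branch of the
system through `(y, y′)(0) = (0, 1)`, i.e. `y_s = x + O(x²)`. [cite: CoddingtonLevinson1955, Ch. 4 §8] -/
def scalarSmallSol (pc qc : ℕ → 𝕜) : 𝕜 → 𝕜 × 𝕜 :=
  frobeniusSol (scalarSysM pc qc) (fun _ => 0) (scalarSysR pc qc) ((0 : 𝕜), (1 : 𝕜))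

/-- **The regular part** `(η, ζ)` of the logarithmic branch through `(η, ζ)(0) = (η₀, ζ₀)`, with logarithmic
coefficient `κ = −q₀ η₀`: the analytic branch of `x W′ = M(x) W − κ Y_s(x)`; the large solution is
`y_L = κ log(x) y_s + η`, with derivative `y_L′ = κ log(x) y_s′ + ζ` (`ζ = η′ + κ y_s/x`). The free parameter `ζ₀`
shifts `y_L` by multiples of `y_s` (`η′(0) = ζ₀ − κ`). [cite: CoddingtonLevinson1955, Ch. 4 §8] -/
def scalarLogRegSol (pc qc : ℕ → 𝕜) (η₀ ζ₀ : 𝕜) : 𝕜 → 𝕜 × 𝕜 :=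
  frobeniusSol (scalarSysM pc qc)
    (logBranchInhom (scalarSysM pc qc) (scalarSysR pc qc) ((0 : 𝕜), (1 : 𝕜)) (-(qc 0) * η₀))
    (scalarSysR pc qc) (η₀, ζ₀)


/-- **The logarithmic branch** `(y_L, y_L′) = κ ℓ • (y_s, y_s′) + (η, ζ)`, `κ = −q₀ η₀`, for a supplied branch `ℓ` of
the logarithm (`Real.log = log|·|` on either real half-line, a branch of `Complex.log`, …).
[cite: CoddingtonLevinson1955, Ch. 4 §8] -/
def scalarLogSol (pc qc : ℕ → 𝕜) (η₀ ζ₀ : 𝕜) (ℓ : 𝕜 → 𝕜) : 𝕜 → 𝕜 × 𝕜 :=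
  frobeniusLogSol (scalarSysM pc qc) (scalarSysR pc qc) ((0 : 𝕜), (1 : 𝕜)) (-(qc 0) * η₀) (η₀, ζ₀) ℓ

/-- `y_L = κ ℓ y_s + η`. [cite: CoddingtonLevinson1955, Ch. 4 §8] -/
theorem scalarLogSol_fst (pc qc : ℕ → 𝕜) (η₀ ζ₀ : 𝕜) (ℓ : 𝕜 → 𝕜) (x : 𝕜) :
    (scalarLogSol pc qc η₀ ζ₀ ℓ x).1 =
      -(qc 0) * η₀ * ℓ x * (scalarSmallSol pc qc x).1 + (scalarLogRegSol pc qc η₀ ζ₀ x).1 := by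
  simp only [scalarLogSol, frobeniusLogSol, scalarSmallSol, scalarLogRegSol, Prod.fst_add, Prod.smul_fst,
    smul_eq_mul, mul_assoc]

/-- `y_L′ = κ ℓ y_s′ + ζ`. [cite: CoddingtonLevinson1955, Ch. 4 §8] -/
theorem scalarLogSol_snd (pc qc : ℕ → 𝕜) (η₀ ζ₀ : 𝕜) (ℓ : 𝕜 → 𝕜) (x : 𝕜) :
    (scalarLogSol pc qc η₀ ζ₀ ℓ x).2 =
      -(qc 0) * η₀ * ℓ x * (scalarSmallSol pc qc x).2 + (scalarLogRegSol pc qc η₀ ζ₀ x).2 := by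
  simp only [scalarLogSol, frobeniusLogSol, scalarSmallSol, scalarLogRegSol, Prod.snd_add, Prod.smul_snd,
    smul_eq_mul, mul_assoc]

/-- `1 ≤ c`. [cite: CoddingtonLevinson1955, Ch. 4 §8] -/
theorem one_le_scalarLogC (qc : ℕ → 𝕜) : 1 ≤ scalarLogC qc := le_max_left _ _

/-- The resonant compatibility `M₀ (η₀, ζ₀) = κ • (0, 1)` with `κ = −q₀ η₀` (uses `p₀ = 0`): the condition that fixes
the logarithmic coefficient. [cite: CoddingtonLevinson1955, Ch. 4 §8] -/
theorem scalarSysM_zero_resonant (hp0 : pc 0 = 0) (η₀ ζ₀ : 𝕜) :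
    scalarSysM pc qc 0 (η₀, ζ₀) = (-(qc 0) * η₀) • ((0 : 𝕜), (1 : 𝕜)) := by
  ext <;> simp [scalarSysM_apply, hp0]

namespace IsScalarLogData

/-- Frobenius data of the small solution (`μ = 1`, compatibility = `p₀ = 0`). [cite: CoddingtonLevinson1955, Ch. 4 §8] -/
theorem small (h : IsScalarLogData pc qc p q a K ρ₀) :
    IsFrobeniusData (scalarSysM pc qc) (fun _ => 0) (scalarSysR pc qc) ((0 : 𝕜), (1 : 𝕜)) a (2 * K + a⁻¹) 0
      (scalarLogC qc) := by
  have hres : ∀ n : ℕ, 1 ≤ n → (1 : ℝ) * n ≤ ‖(n : 𝕜) + pc 0‖ := fun n _ => by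
    rw [h.pc_zero, add_zero, RCLike.norm_natCast, one_mul]
  have h0 : qc 0 * 0 + pc 0 * 1 = 0 := by rw [h.pc_zero]; ring
  have hD := isFrobeniusData_scalarSys pc qc h.a_pos h.K_nonneg one_pos h.norm_pc_le h.norm_qc_le hres h0
  simpa only [scalarLogC, div_one] using hD

/-- Frobenius data of the regular part of the log branch. [cite: CoddingtonLevinson1955, Ch. 4 §8] -/
theorem logReg (h : IsScalarLogData pc qc p q a K ρ₀) (η₀ ζ₀ : 𝕜) :
    IsFrobeniusData (scalarSysM pc qc)
      (logBranchInhom (scalarSysM pc qc) (scalarSysR pc qc) ((0 : 𝕜), (1 : 𝕜)) (-(qc 0) * η₀))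
      (scalarSysR pc qc) (η₀, ζ₀) (scalarLogLam qc a K) (2 * K + a⁻¹) (‖-(qc 0) * η₀‖ * ‖((0 : 𝕜), (1 : 𝕜))‖)
      (scalarLogC qc) :=
  h.small.logBranch (scalarSysM_zero_resonant h.pc_zero η₀ ζ₀)

/-- `0 < λ'` and `a ≤ λ ≤ λ'`. [cite: CoddingtonLevinson1955, Ch. 4 §8] -/
theorem rates (h : IsScalarLogData pc qc p q a K ρ₀) :
    a ≤ scalarLogLam qc a K ∧ scalarLogLam qc a K ≤ scalarLogLam' qc a K ∧ 0 < scalarLogLam' qc a K := by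
  have ha := h.a_pos
  have hK := h.K_nonneg
  have hc := one_le_scalarLogC qc
  have hf : 1 ≤ 1 + 2 * scalarLogC qc * (2 * K + a⁻¹) := by
    have : 0 ≤ 2 * scalarLogC qc * (2 * K + a⁻¹) := by positivity
    linarith
  have h1 : a ≤ scalarLogLam qc a K := le_mul_of_one_le_right ha.le hf
  have h2 : scalarLogLam qc a K ≤ scalarLogLam' qc a K :=
    le_mul_of_one_le_right (ha.le.trans h1) hf
  exact ⟨h1, h2, lt_of_lt_of_le ha (h1.trans h2)⟩

/-- The radius is positive. [cite: CoddingtonLevinson1955, Ch. 4 §8] -/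
theorem radius_pos (h : IsScalarLogData pc qc p q a K ρ₀) : 0 < scalarLogRadius qc a K ρ₀ := by
  have := h.rates.2.2
  exact lt_min h.ρ₀_pos (by positivity)

/-- Inside the radius: `‖x‖ < ρ₀`, `λ'‖x‖ < 1`, `λ‖x‖ < 1`, `a‖x‖ < 1`. [cite: CoddingtonLevinson1955, Ch. 4 §8] -/
theorem of_norm_lt_radius (h : IsScalarLogData pc qc p q a K ρ₀) {x : 𝕜} (hx : ‖x‖ < scalarLogRadius qc a K ρ₀) :
    ‖x‖ < ρ₀ ∧ scalarLogLam' qc a K * ‖x‖ < 1 ∧ scalarLogLam qc a K * ‖x‖ < 1 ∧ a * ‖x‖ < 1 := by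
  obtain ⟨h1, h2, h3⟩ := h.rates
  have hx0 := norm_nonneg x
  have hρ₀ : ‖x‖ < ρ₀ := hx.trans_le (min_le_left _ _)
  have hl' : scalarLogLam' qc a K * ‖x‖ < 1 := by
    have hx1 : ‖x‖ < 1 / (scalarLogLam' qc a K + 1) := hx.trans_le (min_le_right _ _)
    rw [lt_div_iff₀ (by positivity)] at hx1
    nlinarith
  exact ⟨hρ₀, hl', lt_of_le_of_lt (mul_le_mul_of_nonneg_right h2 hx0) hl',
    lt_of_le_of_lt (mul_le_mul_of_nonneg_right h1 hx0) (lt_of_le_of_lt (mul_le_mul_of_nonneg_right h2 hx0) hl')⟩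

/-- The operator series evaluated inside the radius: `(Σ xᵏ • Mₖ)(w₁, w₂) = (x w₂, −q(x) w₁ − p(x) w₂)`.
[cite: CoddingtonLevinson1955, Ch. 4 §8] -/
theorem tsum_apply (h : IsScalarLogData pc qc p q a K ρ₀) {x : 𝕜} (hx : ‖x‖ < scalarLogRadius qc a K ρ₀)
    (w : 𝕜 × 𝕜) : (∑' k, x ^ k • scalarSysM pc qc k) w = (x * w.2, -(q x) * w.1 - p x * w.2) := by
  obtain ⟨hρ₀, -, -, hax⟩ := h.of_norm_lt_radius hx
  exact tsum_scalarSysM_apply pc qc h.a_pos.le h.small.norm_M_le' hax (h.hasSum_p x hρ₀) (h.hasSum_q x hρ₀) w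

/-- **THE SMALL SOLUTION.** `(y_s, y_s′)(0) = (0, 1)`; inside the radius `(y_s, y_s′)` is differentiable,
`y_s′` is the derivative of `y_s` (`x ≠ 0`), and `x y_s″ + p y_s′ + q y_s = 0`; coefficient majorant
`‖sₖ‖ ≤ ‖(0,1)‖ λᵏ`. [cite: CoddingtonLevinson1955, Ch. 4 §8] -/
theorem smallSol (h : IsScalarLogData pc qc p q a K ρ₀) :
    scalarSmallSol pc qc 0 = ((0 : 𝕜), (1 : 𝕜)) ∧
    ∀ x : 𝕜, ‖x‖ < scalarLogRadius qc a K ρ₀ →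
      DifferentiableAt 𝕜 (scalarSmallSol pc qc) x ∧
      (x ≠ 0 → HasDerivAt (fun z => (scalarSmallSol pc qc z).1) ((scalarSmallSol pc qc x).2) x) ∧
      HasDerivAt (fun z => (scalarSmallSol pc qc z).2) ((deriv (scalarSmallSol pc qc) x).2) x ∧
      x * (deriv (scalarSmallSol pc qc) x).2 + p x * (scalarSmallSol pc qc x).2
        + q x * (scalarSmallSol pc qc x).1 = 0 := by
  refine ⟨frobeniusSol_zero _ _ _ _, fun x hx => ?_⟩
  obtain ⟨-, -, hl, -⟩ := h.of_norm_lt_radius hx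
  obtain ⟨-, hdiff, hode, -⟩ := h.small.analyticBranch.2.2.1 x hl
  change DifferentiableAt 𝕜 (scalarSmallSol pc qc) x at hdiff
  change x • deriv (scalarSmallSol pc qc) x =
    (∑' k, x ^ k • scalarSysM pc qc k) (scalarSmallSol pc qc x) + ∑' k : ℕ, x ^ k • (0 : 𝕜 × 𝕜) at hode
  have hd := hdiff.hasDerivAt
  rw [h.tsum_apply hx, tsum_congr (fun k => smul_zero (x ^ k)), tsum_zero, add_zero] at hode
  have e1 := congrArg Prod.fst hode
  have e2 := congrArg Prod.snd hode
  simp only [Prod.smul_fst, Prod.smul_snd, smul_eq_mul] at e1 e2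
  refine ⟨hdiff, fun hx0 => ?_, (ContinuousLinearMap.snd 𝕜 𝕜 𝕜).hasFDerivAt.comp_hasDerivAt x hd, ?_⟩
  · have key : (deriv (scalarSmallSol pc qc) x).1 = (scalarSmallSol pc qc x).2 := mul_left_cancel₀ hx0 e1
    rw [← key]
    exact (ContinuousLinearMap.fst 𝕜 𝕜 𝕜).hasFDerivAt.comp_hasDerivAt x hd
  · rw [e2]; ring

/-- **THE REGULAR PART OF THE LOG BRANCH.** `(η, ζ)(0) = (η₀, ζ₀)`; inside the radius `(η, ζ)` is differentiable with
`x η′ = x ζ − κ y_s` and `x ζ′ + p ζ + q η = −κ y_s′`, `κ = −q₀ η₀`; coefficient majorant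
`‖wₖ‖ ≤ max ‖(η₀,ζ₀)‖ (2c‖κ‖) λ'ᵏ`. [cite: CoddingtonLevinson1955, Ch. 4 §8] -/
theorem logRegSol (h : IsScalarLogData pc qc p q a K ρ₀) (η₀ ζ₀ : 𝕜) :
    scalarLogRegSol pc qc η₀ ζ₀ 0 = (η₀, ζ₀) ∧
    ∀ x : 𝕜, ‖x‖ < scalarLogRadius qc a K ρ₀ →
      DifferentiableAt 𝕜 (scalarLogRegSol pc qc η₀ ζ₀) x ∧
      HasDerivAt (fun z => (scalarLogRegSol pc qc η₀ ζ₀ z).1) ((deriv (scalarLogRegSol pc qc η₀ ζ₀) x).1) x ∧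
      HasDerivAt (fun z => (scalarLogRegSol pc qc η₀ ζ₀ z).2) ((deriv (scalarLogRegSol pc qc η₀ ζ₀) x).2) x ∧
      x * (deriv (scalarLogRegSol pc qc η₀ ζ₀) x).1 =
        x * (scalarLogRegSol pc qc η₀ ζ₀ x).2 - (-(qc 0) * η₀) * (scalarSmallSol pc qc x).1 ∧
      x * (deriv (scalarLogRegSol pc qc η₀ ζ₀) x).2 + p x * (scalarLogRegSol pc qc η₀ ζ₀ x).2
        + q x * (scalarLogRegSol pc qc η₀ ζ₀ x).1 = -(-(qc 0) * η₀) * (scalarSmallSol pc qc x).2 := by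
  refine ⟨frobeniusSol_zero _ _ _ _, fun x hx => ?_⟩
  obtain ⟨-, hl', hl, -⟩ := h.of_norm_lt_radius hx
  obtain ⟨-, hdiff, hode, -⟩ := (h.logReg η₀ ζ₀).analyticBranch.2.2.1 x hl'
  change DifferentiableAt 𝕜 (scalarLogRegSol pc qc η₀ ζ₀) x at hdiff
  change x • deriv (scalarLogRegSol pc qc η₀ ζ₀) x =
    (∑' k, x ^ k • scalarSysM pc qc k) (scalarLogRegSol pc qc η₀ ζ₀ x)
      + ∑' k : ℕ, x ^ k • logBranchInhom (scalarSysM pc qc) (scalarSysR pc qc) ((0 : 𝕜), (1 : 𝕜))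
          (-(qc 0) * η₀) k at hode
  have hd := hdiff.hasDerivAt
  have hg := (h.small.hasSum_logBranchInhom (-(qc 0) * η₀) hl).tsum_eq
  change ∑' k : ℕ, x ^ k • logBranchInhom (scalarSysM pc qc) (scalarSysR pc qc) ((0 : 𝕜), (1 : 𝕜))
      (-(qc 0) * η₀) k = -((-(qc 0) * η₀) • scalarSmallSol pc qc x) at hg
  rw [h.tsum_apply hx, hg] at hode
  have e1 := congrArg Prod.fst hode
  have e2 := congrArg Prod.snd hode
  simp only [Prod.smul_fst, Prod.smul_snd, Prod.fst_add, Prod.snd_add, Prod.fst_neg, Prod.snd_neg,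
    smul_eq_mul] at e1 e2
  refine ⟨hdiff, (ContinuousLinearMap.fst 𝕜 𝕜 𝕜).hasFDerivAt.comp_hasDerivAt x hd,
    (ContinuousLinearMap.snd 𝕜 𝕜 𝕜).hasFDerivAt.comp_hasDerivAt x hd, ?_, ?_⟩
  · rw [e1]; ring
  · rw [e2]; ring

/-- **THE LOGARITHMIC BRANCH SOLVES THE EQUATION.** Let `ℓ` have `ℓ′(x) = x⁻¹` at a point `x ≠ 0` inside the
radius. Then `y_L′` (the second component of `scalarLogSol`) is the derivative of `y_L` at `x`, it is itself
differentiable at `x`, and `x y_L″ + p(x) y_L′ + q(x) y_L = 0` at `x`: `y_L = κ log(x)·y_s + η` is the second,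
logarithmically singular, solution of the resonant equation (`κ = −q₀ η₀ ≠ 0` unless `q₀ = 0`, in which case
`y_L = η` is a second ANALYTIC solution). [cite: CoddingtonLevinson1955, Ch. 4 §8] -/
theorem logSol (h : IsScalarLogData pc qc p q a K ρ₀) (η₀ ζ₀ : 𝕜) {ℓ : 𝕜 → 𝕜} {x : 𝕜}
    (hx : ‖x‖ < scalarLogRadius qc a K ρ₀) (hx0 : x ≠ 0) (hℓ : HasDerivAt ℓ x⁻¹ x) :
    HasDerivAt (fun z => (scalarLogSol pc qc η₀ ζ₀ ℓ z).1) ((scalarLogSol pc qc η₀ ζ₀ ℓ x).2) x ∧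
      HasDerivAt (fun z => (scalarLogSol pc qc η₀ ζ₀ ℓ z).2) ((deriv (scalarLogSol pc qc η₀ ζ₀ ℓ) x).2) x ∧
      x * (deriv (scalarLogSol pc qc η₀ ζ₀ ℓ) x).2 + p x * (scalarLogSol pc qc η₀ ζ₀ ℓ x).2
        + q x * (scalarLogSol pc qc η₀ ζ₀ ℓ x).1 = 0 := by
  obtain ⟨-, hl', -, -⟩ := h.of_norm_lt_radius hx
  have hl'' : a * (1 + 2 * scalarLogC qc * (2 * K + a⁻¹)) * (1 + 2 * scalarLogC qc * (2 * K + a⁻¹)) * ‖x‖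
      < 1 := hl'
  obtain ⟨hdiff, hode⟩ :=
    h.small.frobeniusLogSol_ode (scalarSysM_zero_resonant h.pc_zero η₀ ζ₀) hl'' hx0 hℓ
  change DifferentiableAt 𝕜 (scalarLogSol pc qc η₀ ζ₀ ℓ) x at hdiff
  change x • deriv (scalarLogSol pc qc η₀ ζ₀ ℓ) x =
    (∑' k, x ^ k • scalarSysM pc qc k) (scalarLogSol pc qc η₀ ζ₀ ℓ x) at hode
  have hd := hdiff.hasDerivAt
  rw [h.tsum_apply hx] at hode
  have e1 := congrArg Prod.fst hode
  have e2 := congrArg Prod.snd hode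
  simp only [Prod.smul_fst, Prod.smul_snd, smul_eq_mul] at e1 e2
  refine ⟨?_, (ContinuousLinearMap.snd 𝕜 𝕜 𝕜).hasFDerivAt.comp_hasDerivAt x hd, ?_⟩
  · have key : (deriv (scalarLogSol pc qc η₀ ζ₀ ℓ) x).1 = (scalarLogSol pc qc η₀ ζ₀ ℓ x).2 :=
      mul_left_cancel₀ hx0 e1
    rw [← key]
    exact (ContinuousLinearMap.fst 𝕜 𝕜 𝕜).hasFDerivAt.comp_hasDerivAt x hd
  · rw [e2]; ring

end IsScalarLogData

/-! ### The classical statement -/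

/-- **THE LOGARITHMIC FROBENIUS BRANCH OF `x y″ + p(x) y′ + q(x) y = 0`, INDICIAL EXPONENTS `{0, 1}`.** Over
`𝕜 = ℝ` or `ℂ` let `p(x) = Σ pₖ xᵏ`, `q(x) = Σ qₖ xᵏ` on `‖x‖ < ρ₀` with `‖pₖ‖, ‖qₖ‖ ≤ K aᵏ` (`k ≥ 1`, `a > 0`) and
`p₀ = 0`. Then there are `ρ > 0` and `y_s, y_s', η, ζ : 𝕜 → 𝕜`, differentiable on `‖x‖ < ρ`, with
`y_s(0) = 0`, `y_s'(0) = 1`, `η(0) = 1`, `ζ(0) = −q₀`, such that on `‖x‖ < ρ`: `y_s'` is the derivative of `y_s`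
(`x ≠ 0`) and `x y_s″ + p y_s′ + q y_s = 0` (the SMALL solution `y_s = x + …`); `x η′ = x ζ + q₀ y_s` and
`x ζ′ + p ζ + q η = q₀ y_s'` (the REGULAR PART; `ζ = η′ − q₀ y_s/x`, so `ζ(0) = −q₀` is the normalisation
`η′(0) = 0`); and for EVERY point `x ≠ 0` of the disc and every `ℓ` with `ℓ′(x) = x⁻¹` (`Real.log = log|·|` on
either real half-line; a branch of `Complex.log`) the LARGE solution `y_L = −q₀ ℓ y_s + η` has derivative
`y_L' = −q₀ ℓ y_s' + ζ` at `x`, `y_L'` is differentiable at `x`, and `x y_L″ + p y_L′ + q y_L = 0` at `x`. The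
logarithm is present iff `q₀ ≠ 0`; all four functions are power series with the explicit majorants of
`IsScalarLogData.smallSol` / `.logRegSol`. [cite: CoddingtonLevinson1955, Ch. 4 §8];
[cite: Hartman2002, Ch. IV §12]. -/
theorem exists_logBranch_scalar {pc qc : ℕ → 𝕜} {p q : 𝕜 → 𝕜} {a K ρ₀ : ℝ}
    (h : IsScalarLogData pc qc p q a K ρ₀) :
    ∃ ρ : ℝ, 0 < ρ ∧ ∃ ys ys' η ζ : 𝕜 → 𝕜,
      (ys 0 = 0 ∧ ys' 0 = 1 ∧ η 0 = 1 ∧ ζ 0 = -(qc 0)) ∧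
      (DifferentiableOn 𝕜 ys (ball 0 ρ) ∧ DifferentiableOn 𝕜 ys' (ball 0 ρ) ∧
        DifferentiableOn 𝕜 η (ball 0 ρ) ∧ DifferentiableOn 𝕜 ζ (ball 0 ρ)) ∧
      (∀ x : 𝕜, ‖x‖ < ρ → x ≠ 0 → HasDerivAt ys (ys' x) x) ∧
      (∀ x : 𝕜, ‖x‖ < ρ → x * deriv ys' x + p x * ys' x + q x * ys x = 0) ∧
      (∀ x : 𝕜, ‖x‖ < ρ → x * deriv η x = x * ζ x + qc 0 * ys x) ∧
      (∀ x : 𝕜, ‖x‖ < ρ → x * deriv ζ x + p x * ζ x + q x * η x = qc 0 * ys' x) ∧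
      ∀ (ℓ : 𝕜 → 𝕜) (x : 𝕜), ‖x‖ < ρ → x ≠ 0 → HasDerivAt ℓ x⁻¹ x →
        HasDerivAt (fun z => -(qc 0) * ℓ z * ys z + η z) (-(qc 0) * ℓ x * ys' x + ζ x) x ∧
        DifferentiableAt 𝕜 (fun z => -(qc 0) * ℓ z * ys' z + ζ z) x ∧
        x * deriv (fun z => -(qc 0) * ℓ z * ys' z + ζ z) x + p x * (-(qc 0) * ℓ x * ys' x + ζ x)
          + q x * (-(qc 0) * ℓ x * ys x + η x) = 0 := by
  obtain ⟨hS0, hS⟩ := h.smallSol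
  obtain ⟨hW0, hW⟩ := h.logRegSol 1 (-(qc 0))
  set Ys := scalarSmallSol pc qc with hYs
  set W := scalarLogRegSol pc qc 1 (-(qc 0)) with hWdef
  have hball : ∀ x : 𝕜, x ∈ ball (0 : 𝕜) (scalarLogRadius qc a K ρ₀) → ‖x‖ < scalarLogRadius qc a K ρ₀ :=
    fun x hx => by rwa [Metric.mem_ball, dist_zero_right] at hx
  refine ⟨scalarLogRadius qc a K ρ₀, h.radius_pos, fun x => (Ys x).1, fun x => (Ys x).2, fun x => (W x).1,
    fun x => (W x).2, ?_, ?_, ?_, ?_, ?_, ?_, ?_⟩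
  · simp only [hS0, hW0, and_self]
  · exact ⟨fun x hx => ((hS x (hball x hx)).1.fst).differentiableWithinAt,
      fun x hx => ((hS x (hball x hx)).1.snd).differentiableWithinAt,
      fun x hx => ((hW x (hball x hx)).1.fst).differentiableWithinAt,
      fun x hx => ((hW x (hball x hx)).1.snd).differentiableWithinAt⟩
  · exact fun x hx hx0 => (hS x hx).2.1 hx0
  · intro x hx
    obtain ⟨-, -, hd2, hode⟩ := hS x hx
    rw [hd2.deriv]
    exact hode
  · intro x hx
    obtain ⟨-, hd1, -, he1, -⟩ := hW x hx
    rw [hd1.deriv, he1]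
    ring
  · intro x hx
    obtain ⟨-, -, hd2, -, he2⟩ := hW x hx
    rw [hd2.deriv, he2]
    ring
  · intro ℓ x hx hx0 hℓ
    obtain ⟨hd1, hd2, hode⟩ := h.logSol 1 (-(qc 0)) hx hx0 hℓ
    have hf1 : (fun z => (scalarLogSol pc qc 1 (-(qc 0)) ℓ z).1) = fun z => -(qc 0) * ℓ z * (Ys z).1 + (W z).1 := by
      funext z; rw [scalarLogSol_fst, mul_one]
    have hf2 : (fun z => (scalarLogSol pc qc 1 (-(qc 0)) ℓ z).2) = fun z => -(qc 0) * ℓ z * (Ys z).2 + (W z).2 := by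
      funext z; rw [scalarLogSol_snd, mul_one]
    have hv1 : (scalarLogSol pc qc 1 (-(qc 0)) ℓ x).1 = -(qc 0) * ℓ x * (Ys x).1 + (W x).1 := by
      rw [scalarLogSol_fst, mul_one]
    have hv2 : (scalarLogSol pc qc 1 (-(qc 0)) ℓ x).2 = -(qc 0) * ℓ x * (Ys x).2 + (W x).2 := by
      rw [scalarLogSol_snd, mul_one]
    rw [hf1, hv2] at hd1
    rw [hf2] at hd2
    refine ⟨hd1, hd2.differentiableAt, ?_⟩
    rw [hd2.deriv, ← hv1, ← hv2]
    exact hode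

/-- **REAL-LINE FORM.** Over `ℝ`, on BOTH sides of the singular point: for `0 < |x| < ρ` and `ℓ = Real.log`
(`= log|x|`, derivative `x⁻¹` at every `x ≠ 0`), `y_L = κ log|x| y_s + η` solves `x y_L″ + p y_L′ + q y_L = 0` at `x`
with derivative `y_L′ = κ log|x| y_s′ + ζ` — the two-sided representation consumed by the tearing-mode `Δ′`
extraction. [cite: CoddingtonLevinson1955, Ch. 4 §8] -/
theorem IsScalarLogData.logSol_real {pc qc : ℕ → ℝ} {p q : ℝ → ℝ} {a K ρ₀ : ℝ}
    (h : IsScalarLogData pc qc p q a K ρ₀) (η₀ ζ₀ : ℝ) {x : ℝ} (hx : |x| < scalarLogRadius qc a K ρ₀)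
    (hx0 : x ≠ 0) :
    HasDerivAt (fun z => (scalarLogSol pc qc η₀ ζ₀ Real.log z).1) ((scalarLogSol pc qc η₀ ζ₀ Real.log x).2) x ∧
      HasDerivAt (fun z => (scalarLogSol pc qc η₀ ζ₀ Real.log z).2)
        ((deriv (scalarLogSol pc qc η₀ ζ₀ Real.log) x).2) x ∧
      x * (deriv (scalarLogSol pc qc η₀ ζ₀ Real.log) x).2 + p x * (scalarLogSol pc qc η₀ ζ₀ Real.log x).2
        + q x * (scalarLogSol pc qc η₀ ζ₀ Real.log x).1 = 0 :=
  h.logSol η₀ ζ₀ (by rwa [Real.norm_eq_abs]) hx0 (Real.hasDerivAt_log hx0)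

end Resonant


end Literature.Analysis.ODE

end
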